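import Literature.AnabelianGeometry.SemiGraphs.AmbientVocabRmk411
import Literature.AnabelianGeometry.SemiGraphs.AmbientVocabDictionary
import Literature.AnabelianGeometry.SemiGraphs.LocalizationsProperties

/-!
# [SemiAnbd] Prop 4.3 (iii) at the real vocabulary, MODULO the one residual law it consumes («tempered ⇒ proper»)

Mochizuki, *Semi-graphs of anabelioids*, Publ. RIMS **42** (2006), §4 Prop 4.3 (iii) p.53: "a morphism from a
finite open object to a tempered object is not an isomorphism of semi-graphs of anabelioids"; proof p.53: a
finite open object has a non-isolated open edge which is `𝔾`-closed (p.52), whereas a tempered covering lies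
over a PROPER morphism of semi-graphs (Def 3.5 (ii) p.37 via Def 2.2 (i) p.23 "lies over some proper morphism"),
so its edges over closed edges of `𝔾` are closed (kurims `paper:url-f33ace170ff4`).
[cite: MochizukiSemiAnbd2006, Prop 4.3 (iii), p. 53]

PROOF-ONLY (abc-iut-L3-t7 gen 4, L3-lead row α22-7/α23-2 «§4–§5 statements at `ofReal` #2»).  At
`𝓥 := SemiAnbdVocab.ofReal R` (`AmbientVocabOfReal.lean`) the class of TEMPERED arrows is the free residual
`R.IsTempered` (constrained only by finite étale ⇒ tempered ⇒ locally finite étale), so the container-level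
predicate `Loc.BasicPropertiesStatementIII (SemiAnbdVocab.ofReal R) G Γ` is NOT provable for every `R` (it fails
at the admissible residual `IsTempered := locallyFiniteEtale`, see the seat's NO-GO note).  It IS provable from
exactly the printed law the proof uses, taken as an explicit hypothesis on the residual (no new definition):

* `basicPropertiesStatementIII_ofReal_of_proper` — Prop 4.3 (iii) at `ofReal R` for every residual `R` whose
  tempered arrows into `𝔾` lie over PROPER morphisms of semi-graphs (`SemiGraph.IsProper`: verticial
  cardinalities of edges are preserved);
* `isProper_of_finiteEtale` — finite étale coverings lie over proper morphisms (Def 2.2 (i), first clause of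
  `Hom.IsFiniteEtaleCoveringOf`), whence
* `basicPropertiesStatementIII_ofReal_trivial` — Prop 4.3 (iii) UNCONDITIONALLY at the degenerate residual
  `SgA.BridgeResidual.trivial` (tempered := finite étale; `AmbientVocabDictionary.lean`).

Route (print's): `e` the non-isolated open `𝔾`-closed edge of the finite open `X`; by Rmk 4.1.1 at `ofReal`
(`Loc.gOpenClosedPreservedStatement_ofReal`, abc-iut-L3-t3) the image `f e` is `𝔾`-closed for the induced
structure of the tempered `Y`, i.e. `γ (q (f e))` is closed for some `γ ∈ Γ`, hence `q (f e)` is closed;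
properness of `q` makes `f e` closed; an isomorphism reflects closedness (`ofReal_isClosedEdge_mapE_iff_of_iso`),
contradicting `vertCard e = 1`.  Nothing here takes a side on [IUTchIII] Cor. 3.12; typed ≠ proved elsewhere.
-/

namespace Literature.AnabelianGeometry.SemiGraphs

open CategoryTheory

universe v₁ u₁ u

namespace SgAQuot.SgA

/-- **Finite étale coverings lie over proper morphisms of semi-graphs** ([SemiAnbd] Def 2.2 (i), p.23:
"`𝒢' → 𝒢` … which lies over some proper morphism"): the first clause of `Hom.IsFiniteEtaleCoveringOf`,
transported to the arrow class `finiteEtale` of the Rmk 2.4.2 category. [cite: MochizukiSemiAnbd2006, Def 2.2 (i), p. 23] -/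
theorem isProper_of_finiteEtale {X Y : SgAQuot.{v₁, u₁, u}} {a : X ⟶ Y} (ha : finiteEtale a) :
    SemiGraph.IsProper a.base := by
  obtain ⟨φ, rfl, A, hA, -⟩ := ha
  exact hA.1

end SgAQuot.SgA

namespace Loc

open SgAQuot SgAQuot.SgA SemiAnbdVocab

variable (R : SgA.BridgeResidual.{v₁, u₁, u})

/-- For a tempered object `Y` of `Loc(𝔾, Γ)` at the real vocabulary (structure morphism `q : Y → 𝔾`, induced
local `(𝔾, Γ)`-structure), an edge `e'` of `Y` is `𝔾`-closed iff `q e'` is a closed edge of `𝔾` — the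
`Γ`-orbit of `q e'` consists of images of `q e'` under automorphisms, which preserve and reflect closedness.
[cite: MochizukiSemiAnbd2006, Rmk 4.1.1, p. 51] -/
theorem isGClosed_induced_iff_ofReal {G Y : SgA.{v₁, u₁, u}} {Γ : Subgroup (Aut G)} (q : Y ⟶ G)
    (hq : (SemiAnbdVocab.ofReal R).IsLocallyFiniteEtale q) (e' : Y.toSgA.graph.Edge) :
    (LocalGStructure.induced (SemiAnbdVocab.ofReal R) (Γ := Γ) q hq).IsGClosed (SemiAnbdVocab.ofReal R) e' ↔
      (SemiAnbdVocab.ofReal R).IsClosedEdge ((SemiAnbdVocab.ofReal R).mapE q e') := by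
  have hcenter : (SemiAnbdVocab.ofReal R).mapE ((SemiAnbdVocab.ofReal R).ιE Y e')
      ((SemiAnbdVocab.ofReal R).centerE Y e') = e' := (SemiAnbdVocab.ofReal R).mapE_centerE Y e'
  constructor
  · rintro ⟨e₀, ⟨s, ⟨γ, -, rfl⟩, rfl⟩, hclosed⟩
    rw [(SemiAnbdVocab.ofReal R).mapE_comp, (SemiAnbdVocab.ofReal R).mapE_comp, hcenter] at hclosed
    exact (ofReal_isClosedEdge_mapE_iff_of_iso R γ _).mp hclosed
  · intro hclosed
    refine ⟨(SemiAnbdVocab.ofReal R).mapE q e',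
      ⟨(SemiAnbdVocab.ofReal R).ιE Y e' ≫ q, ⟨1, Γ.one_mem, (Category.comp_id _).symm⟩, ?_⟩, hclosed⟩
    rw [(SemiAnbdVocab.ofReal R).mapE_comp, hcenter]

/-- **[SemiAnbd] Prop 4.3 (iii) at the real vocabulary, modulo «tempered ⇒ proper»**: if the residual's
tempered arrows into `𝔾` lie over proper morphisms of semi-graphs (Def 3.5 (ii) via Def 2.2 (i) — true of
print's tempered coverings; an explicit hypothesis on the free residual, not a new fact), then no morphism of
`Loc(𝔾, Γ)` from a finite open object to a tempered object is an isomorphism of semi-graphs of anabelioids.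
[cite: MochizukiSemiAnbd2006, Prop 4.3 (iii), p. 53] -/
theorem basicPropertiesStatementIII_ofReal_of_proper (G : SgA.{v₁, u₁, u}) (Γ : Subgroup (Aut G))
    (hproper : ∀ {H : SgA.{v₁, u₁, u}} (q : H ⟶ G), R.IsTempered q → SemiGraph.IsProper q.hom.hom.base) :
    BasicPropertiesStatementIII (SemiAnbdVocab.ofReal R) G Γ := by
  intro _ X Y f hX hY hiso
  -- the tempered object `Y`: structure morphism `q`, induced local structure
  obtain ⟨q, hq⟩ := Option.isSome_iff_exists.mp hY
  obtain ⟨-, hqT, hqlfe, hYL⟩ := Y.tempered_wf q hq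
  -- the finite open object `X`: a non-isolated open edge `e` which is `𝔾`-closed
  obtain ⟨e, hcard, hGclosed⟩ := (X.finOpen_wf hX).exists_edge
  -- Rmk 4.1.1: `f e` is `𝔾`-closed for `Y`'s (induced) local structure
  have hG' := ((gOpenClosedPreservedStatement_ofReal R G Γ) X.U Y.U X.L Y.L f.hom f.cond.1
    (f.cond.2.2.2 hX) e).2 hGclosed
  rw [hYL, isGClosed_induced_iff_ofReal R q hqlfe] at hG'
  -- `q (f e)` is closed in `𝔾`; properness of `q` makes `f e` closed in `Y`
  rw [ofReal_isClosedEdge_iff] at hG'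
  have hfe : Y.U.toSgA.graph.IsClosedEdge ((SemiAnbdVocab.ofReal R).mapE f.hom e) := by
    change Y.U.toSgA.graph.vertCard _ = 2
    rw [← hproper q hqT ((SemiAnbdVocab.ofReal R).mapE f.hom e)]
    exact hG'
  -- the isomorphism `f` reflects closedness: `e` is closed in `X`, contradicting `vertCard e = 1`
  have he : (SemiAnbdVocab.ofReal R).IsClosedEdge e :=
    (ofReal_isClosedEdge_mapE_iff_of_iso R (asIso f.hom) e).mp
      ((ofReal_isClosedEdge_iff R Y.U _).mpr hfe)
  rw [ofReal_isClosedEdge_iff] at he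
  change X.U.toSgA.graph.vertCard e = 2 at he
  rw [ofReal_vertCard_eq] at hcard
  omega

/-- **[SemiAnbd] Prop 4.3 (iii) UNCONDITIONALLY at the degenerate residual** `SgA.BridgeResidual.trivial`
(tempered := finite étale, `AmbientVocabDictionary.lean`): finite étale coverings lie over proper morphisms
(`isProper_of_finiteEtale`), so the hypothesis of `basicPropertiesStatementIII_ofReal_of_proper` holds there.
A non-vacuity instance of the conditional theorem, labelled as such — NOT print's tempered class.
[cite: MochizukiSemiAnbd2006, Prop 4.3 (iii), p. 53] -/
theorem basicPropertiesStatementIII_ofReal_trivial (G : SgA.{v₁, u₁, u}) (Γ : Subgroup (Aut G)) :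
    BasicPropertiesStatementIII (SemiAnbdVocab.ofReal SgA.BridgeResidual.trivial.{v₁, u₁, u}) G Γ :=
  basicPropertiesStatementIII_ofReal_of_proper _ G Γ fun _ hq => isProper_of_finiteEtale hq

end Loc

end Literature.AnabelianGeometry.SemiGraphs
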